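import Summits.AtomisticToContinuum.BoseEinsteinCondensation.Theorems.BECThomsonPrincipleGDTransferSeededWitnessDefs
import Summits.AtomisticToContinuum.BoseEinsteinCondensation.Theorems.BECThomsonPrincipleGDTransferSeededProjectedDichotomySector
import Summits.AtomisticToContinuum.BoseEinsteinCondensation.Theorems.BECConjugateDominationPuffFloorPositiveMinimiser

/-!
# Route `BECThomsonPrinciple`, crux `GDTransfer` (stmt-AtomisticToContinuum-9482), line `seeded-continuity`:
# stub `stub_plainInteraction`, part 1 of 4 — calculus of weighted forms and the slot operators of the plain pair

Support file (part 1 of 4) of the registered stub `stub_plainInteraction` (`PlainInteractionBound`: the interaction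
double commutator of the PLAIN pair `B_n = a_n†a_0 = Σ_i e_n(x_i)P_i`, `B_n† = a_0†a_n = Σ_i P_i^{(n)}` is
state-independent; parts 2–4: `…SeededPlainInteractionPairs`, `…Bracket`, `…SeededPlainInteraction`).  Two groups of
elementary lemmas, all on continuous functions on `cell^N`:
* **weighted forms** `𝓥_w(f, g) = ∫_{cell^N} w · conj(f) g` for a continuous real weight `w`
  (written out, no new definition): conjugate symmetry, scalars, finite sums in either slot and in the
  weight, the diagonal `𝓥_w(f,f) = ∫ w|f|²`, and the WEIGHTED CAUCHY–SCHWARZ inequality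
  `|𝓥_w(f,g)| ≤ √(∫w|f|²) √(∫w|g|²)` for `w ≥ 0` (`ℝ≥0∞` Hölder, no integrability bookkeeping);
* **slot operators** `b_i g = e_n(x_i)·P_i g` (`cellWave`, `Negative.cellAvg`) and `P_i^{(n)} = fourierAvg n i`:
  a factor flat in slot `i` passes through `P_i` and `P_i^{(n)}` (`cellAvg_mul_flat`, `fourierAvg_mul_flat`),
  linearity over finite sums, the MIXED COMMUTATION `b_i P_l^{(n)} = P_l^{(n)} b_i` for `i ≠ l`
  (`up_down_comm`, Fubini on `cell × cell` via `cellAvg_comm`), and ADJOINTNESS AGAINST A WEIGHT FLAT IN THE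
  SLOT: `𝓥_w(b_l f, g) = 𝓥_w(f, P_l^{(n)} g)`, `𝓥_w(P_l^{(n)} f, g) = 𝓥_w(f, b_l g)` when `w` does not depend
  on `x_l` (`form_up_adjoint`, `form_down_adjoint`; `Negative.integral_conj_mul_cellAvg`); registered helper statement
  `plainInteraction_form_up_adjoint`.
All [folklore] (KennedyLiebShastry1988 §2; arXiv:1211.2778 §2; LSSY2005 App. A).
-/

noncomputable section

open MeasureTheory Filter
open scoped ENNReal NNReal ComplexConjugate

namespace Summit.AtomisticToContinuum.BoseEinsteinCondensation.Cruxes.GDTransfer.Seeded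

namespace PlainInteraction

open Literature.MathematicalPhysics.QuantumManyBody.BoseGas
open Summit.AtomisticToContinuum.BoseEinsteinCondensation.Theorems.GaussianDominationCan.Negative
open Summit.AtomisticToContinuum.BoseEinsteinCondensation.Cruxes.GDTransfer.DysonDressedWitness
open Lnss Sector

variable {N m : ℕ} {L : ℝ}

/-! ## Weighted forms `∫ w conj(f) g` -/

/-- The integrand of a weighted form with continuous weight and entries is integrable on the cell. [folklore] -/
theorem integrable_form {w : Config N → ℝ} {f g : Config N → ℂ} (hw : Continuous w) (hf : Continuous f)
    (hg : Continuous g) :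
    Integrable (fun X => ((w X : ℝ) : ℂ) * (conj (f X) * g X))
      ((volume : Measure (Config N)).restrict (cellN N L)) :=
  integrableOn_cellN ((Complex.continuous_ofReal.comp hw).mul ((Complex.continuous_conj.comp hf).mul hg)) L

/-- **Conjugate symmetry** of a real-weighted form: `𝓥_w(g, f) = conj 𝓥_w(f, g)`. [folklore] -/
theorem form_conj_symm (w : Config N → ℝ) (f g : Config N → ℂ) :
    ∫ X in cellN N L, ((w X : ℝ) : ℂ) * (conj (g X) * f X) =
      conj (∫ X in cellN N L, ((w X : ℝ) : ℂ) * (conj (f X) * g X)) := by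
  rw [← integral_conj]
  refine integral_congr_ae (Eventually.of_forall fun X => ?_)
  simp only [map_mul, Complex.conj_ofReal, Complex.conj_conj]
  ring

/-- A scalar in the first slot comes out conjugated. [folklore] -/
theorem form_const_mul_left (w : Config N → ℝ) (a : ℂ) (f g : Config N → ℂ) :
    ∫ X in cellN N L, ((w X : ℝ) : ℂ) * (conj (a * f X) * g X) =
      conj a * ∫ X in cellN N L, ((w X : ℝ) : ℂ) * (conj (f X) * g X) := by
  rw [← integral_const_mul]
  refine integral_congr_ae (Eventually.of_forall fun X => ?_)
  simp only [map_mul]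
  ring

/-- A scalar in the second slot comes out. [folklore] -/
theorem form_const_mul_right (w : Config N → ℝ) (a : ℂ) (f g : Config N → ℂ) :
    ∫ X in cellN N L, ((w X : ℝ) : ℂ) * (conj (f X) * (a * g X)) =
      a * ∫ X in cellN N L, ((w X : ℝ) : ℂ) * (conj (f X) * g X) := by
  rw [← integral_const_mul]
  refine integral_congr_ae (Eventually.of_forall fun X => ?_)
  simp only
  ring

/-- **Finite sums in the first slot.** [folklore] -/
theorem form_sum_left {ι : Type*} (s : Finset ι) {w : Config N → ℝ} (hw : Continuous w)
    {f : ι → Config N → ℂ} (hf : ∀ i ∈ s, Continuous (f i)) {g : Config N → ℂ} (hg : Continuous g) :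
    ∫ X in cellN N L, ((w X : ℝ) : ℂ) * (conj (∑ i ∈ s, f i X) * g X) =
      ∑ i ∈ s, ∫ X in cellN N L, ((w X : ℝ) : ℂ) * (conj (f i X) * g X) := by
  rw [← integral_finsetSum s fun i hi => integrable_form hw (hf i hi) hg]
  refine integral_congr_ae (Eventually.of_forall fun X => ?_)
  simp only [map_sum, Finset.sum_mul, Finset.mul_sum]

/-- **Finite sums in the second slot.** [folklore] -/
theorem form_sum_right {ι : Type*} (s : Finset ι) {w : Config N → ℝ} (hw : Continuous w)
    {f : Config N → ℂ} (hf : Continuous f) {g : ι → Config N → ℂ} (hg : ∀ i ∈ s, Continuous (g i)) :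
    ∫ X in cellN N L, ((w X : ℝ) : ℂ) * (conj (f X) * ∑ i ∈ s, g i X) =
      ∑ i ∈ s, ∫ X in cellN N L, ((w X : ℝ) : ℂ) * (conj (f X) * g i X) := by
  rw [← integral_finsetSum s fun i hi => integrable_form hw hf (hg i hi)]
  refine integral_congr_ae (Eventually.of_forall fun X => ?_)
  simp only [Finset.mul_sum]

/-- **Finite sums in the weight.** [folklore] -/
theorem form_sum_weight {ι : Type*} (s : Finset ι) {w : ι → Config N → ℝ} (hw : ∀ k ∈ s, Continuous (w k))
    {f g : Config N → ℂ} (hf : Continuous f) (hg : Continuous g) :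
    ∫ X in cellN N L, ((∑ k ∈ s, w k X : ℝ) : ℂ) * (conj (f X) * g X) =
      ∑ k ∈ s, ∫ X in cellN N L, ((w k X : ℝ) : ℂ) * (conj (f X) * g X) := by
  rw [← integral_finsetSum s fun k hk => integrable_form (hw k hk) hf hg]
  refine integral_congr_ae (Eventually.of_forall fun X => ?_)
  simp only [Complex.ofReal_sum, Finset.sum_mul]

/-- **The diagonal of a weighted form** is the real number `∫ w|f|²`. [folklore] -/
theorem form_self (w : Config N → ℝ) (f : Config N → ℂ) :
    ∫ X in cellN N L, ((w X : ℝ) : ℂ) * (conj (f X) * f X) =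
      ((∫ X in cellN N L, w X * ‖f X‖ ^ 2 : ℝ) : ℂ) := by
  simp_rw [Complex.conj_mul', ← Complex.ofReal_pow, ← Complex.ofReal_mul]
  exact integral_ofReal

/-- The real weighted square integral `∫ w|f|²` read in `ℝ≥0∞`: for `w ≥ 0` continuous and `f` continuous,
`ofReal (∫ w|f|²) = ∫⁻ ofReal(w)·‖f‖₊²`. [folklore] -/
theorem ofReal_integral_weight_norm_sq {w : Config N → ℝ} (hw : Continuous w) (hw0 : ∀ X, 0 ≤ w X)
    {f : Config N → ℂ} (hf : Continuous f) :
    ENNReal.ofReal (∫ X in cellN N L, w X * ‖f X‖ ^ 2) =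
      ∫⁻ X in cellN N L, ENNReal.ofReal (w X) * ((‖f X‖₊ : ℝ≥0∞)) ^ 2 := by
  rw [ofReal_integral_eq_lintegral_ofReal
    (integrableOn_cellN (f := fun X => w X * ‖f X‖ ^ 2) (hw.mul (hf.norm.pow 2)) L)
    (Eventually.of_forall fun X => mul_nonneg (hw0 X) (sq_nonneg _))]
  refine lintegral_congr fun X => ?_
  rw [ENNReal.ofReal_mul (hw0 X), coe_nnnorm_sq_eq_ofReal]

/-- **Weighted Cauchy–Schwarz**: for a continuous weight `w ≥ 0` and continuous `f, g`,
`|∫ w conj(f) g| ≤ √(∫ w|f|²) · √(∫ w|g|²)` (Hölder `2,2` in `ℝ≥0∞` for `√w|f|`, `√w|g|`). [folklore] -/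
theorem norm_form_le_sqrt_mul_sqrt {w : Config N → ℝ} (hw : Continuous w) (hw0 : ∀ X, 0 ≤ w X)
    {f g : Config N → ℂ} (hf : Continuous f) (hg : Continuous g) :
    ‖∫ X in cellN N L, ((w X : ℝ) : ℂ) * (conj (f X) * g X)‖ ≤
      Real.sqrt (∫ X in cellN N L, w X * ‖f X‖ ^ 2) * Real.sqrt (∫ X in cellN N L, w X * ‖g X‖ ^ 2) := by
  set μ : Measure (Config N) := (volume : Measure (Config N)).restrict (cellN N L) with hμ
  set A : ℝ := ∫ X in cellN N L, w X * ‖f X‖ ^ 2 with hA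
  set B : ℝ := ∫ X in cellN N L, w X * ‖g X‖ ^ 2 with hB
  have hA0 : 0 ≤ A := integral_nonneg fun X => mul_nonneg (hw0 X) (sq_nonneg _)
  have hB0 : 0 ≤ B := integral_nonneg fun X => mul_nonneg (hw0 X) (sq_nonneg _)
  -- the two `ℝ≥0∞` factors `√w |f|`, `√w |g|`
  set F : Config N → ℝ≥0∞ := fun X => ENNReal.ofReal (Real.sqrt (w X)) * (‖f X‖₊ : ℝ≥0∞) with hF
  set G : Config N → ℝ≥0∞ := fun X => ENNReal.ofReal (Real.sqrt (w X)) * (‖g X‖₊ : ℝ≥0∞) with hG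
  have hsw : Measurable fun X => ENNReal.ofReal (Real.sqrt (w X)) :=
    ENNReal.measurable_ofReal.comp (Real.continuous_sqrt.measurable.comp hw.measurable)
  have hFm : AEMeasurable F μ := (hsw.mul hf.measurable.nnnorm.coe_nnreal_ennreal).aemeasurable
  have hGm : AEMeasurable G μ := (hsw.mul hg.measurable.nnnorm.coe_nnreal_ennreal).aemeasurable
  have hsq : ∀ X, ENNReal.ofReal (Real.sqrt (w X)) ^ 2 = ENNReal.ofReal (w X) := fun X => by
    rw [← ENNReal.ofReal_pow (Real.sqrt_nonneg _), Real.sq_sqrt (hw0 X)]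
  have hF2 : ∫⁻ X, F X ^ 2 ∂μ = ENNReal.ofReal A := by
    rw [hA, ofReal_integral_weight_norm_sq hw hw0 hf]
    exact lintegral_congr fun X => by rw [hF, mul_pow, hsq]
  have hG2 : ∫⁻ X, G X ^ 2 ∂μ = ENNReal.ofReal B := by
    rw [hB, ofReal_integral_weight_norm_sq hw hw0 hg]
    exact lintegral_congr fun X => by rw [hG, mul_pow, hsq]
  -- the integrand has `ℝ≥0∞`-norm `F·G`
  have hnorm : ∀ X, ‖((w X : ℝ) : ℂ) * (conj (f X) * g X)‖ₑ = F X * G X := by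
    intro X
    have hww : Real.sqrt (w X) * ‖f X‖ * (Real.sqrt (w X) * ‖g X‖) = w X * (‖f X‖ * ‖g X‖) := by
      have h := Real.mul_self_sqrt (hw0 X)
      linear_combination (‖f X‖ * ‖g X‖) * h
    calc ‖((w X : ℝ) : ℂ) * (conj (f X) * g X)‖ₑ
        = ENNReal.ofReal (w X * (‖f X‖ * ‖g X‖)) := by
          rw [← ofReal_norm, norm_mul, norm_mul, Complex.norm_conj, Complex.norm_real,
            Real.norm_of_nonneg (hw0 X)]
      _ = F X * G X := by
          rw [← hww, hF, hG]
          simp only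
          rw [ENNReal.ofReal_mul (mul_nonneg (Real.sqrt_nonneg _) (norm_nonneg _)),
            ENNReal.ofReal_mul (Real.sqrt_nonneg _), ENNReal.ofReal_mul (Real.sqrt_nonneg _),
            ofReal_norm, ofReal_norm, enorm_eq_nnnorm, enorm_eq_nnnorm]
  have hhalf : ∀ a : ℝ≥0∞, a ^ (1 / (2 : ℝ)) = a ^ (2 : ℝ)⁻¹ := fun a => by rw [one_div]
  have key : (‖∫ X, ((w X : ℝ) : ℂ) * (conj (f X) * g X) ∂μ‖ₑ) ≤
      ENNReal.ofReal (Real.sqrt A * Real.sqrt B) := by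
    calc (‖∫ X, ((w X : ℝ) : ℂ) * (conj (f X) * g X) ∂μ‖ₑ)
        ≤ ∫⁻ X, ‖((w X : ℝ) : ℂ) * (conj (f X) * g X)‖ₑ ∂μ := enorm_integral_le_lintegral_enorm _
      _ = ∫⁻ X, (F * G) X ∂μ := lintegral_congr fun X => by rw [hnorm, Pi.mul_apply]
      _ ≤ (∫⁻ X, F X ^ (2 : ℝ) ∂μ) ^ (1 / (2 : ℝ)) * (∫⁻ X, G X ^ (2 : ℝ) ∂μ) ^ (1 / (2 : ℝ)) :=
          ENNReal.lintegral_mul_le_Lp_mul_Lq μ Real.HolderConjugate.two_two hFm hGm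
      _ = ENNReal.ofReal A ^ (1 / (2 : ℝ)) * ENNReal.ofReal B ^ (1 / (2 : ℝ)) := by
          simp only [ENNReal.rpow_two, hF2, hG2]
      _ = ENNReal.ofReal (Real.sqrt A * Real.sqrt B) := by
          rw [Real.sqrt_eq_rpow, Real.sqrt_eq_rpow, ENNReal.ofReal_mul (Real.rpow_nonneg hA0 _),
            ENNReal.ofReal_rpow_of_nonneg hA0 (by norm_num), ENNReal.ofReal_rpow_of_nonneg hB0 (by norm_num)]
  rw [← ofReal_norm] at key
  exact (ENNReal.ofReal_le_ofReal_iff (mul_nonneg (Real.sqrt_nonneg _) (Real.sqrt_nonneg _))).1 key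

/-! ## Slot operators: flat factors, sums, mixed commutation -/

/-- **A factor flat in slot `i` passes through `P_i`.** [folklore] -/
theorem cellAvg_mul_flat (i : Fin N) {u : Config N → ℂ} (hu : ∀ X z, u (Function.update X i z) = u X)
    (g : Config N → ℂ) :
    cellAvg N L i (fun X => u X * g X) = fun X => u X * cellAvg N L i g X := by
  funext X
  unfold cellAvg
  simp_rw [hu X]
  rw [integral_const_mul, mul_smul_comm]

/-- **A factor flat in slot `i` passes through `P_i^{(n)}`.** [folklore] -/
theorem fourierAvg_mul_flat (n : Fin 3 → ℤ) (i : Fin (m + 1)) {u : Config (m + 1) → ℂ}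
    (hu : ∀ X z, u (Function.update X i z) = u X) (g : Config (m + 1) → ℂ) :
    fourierAvg m L n i (fun X => u X * g X) = fun X => u X * fourierAvg m L n i g X := by
  funext X
  unfold fourierAvg
  simp_rw [hu X, mul_left_comm _ (u X)]
  rw [integral_const_mul, mul_smul_comm]

/-- `P_i` through a finite sum of continuous functions. [folklore] -/
theorem cellAvg_sum {ι : Type*} (s : Finset ι) {f : ι → Config N → ℂ} (hf : ∀ t ∈ s, Continuous (f t))
    (i : Fin N) :
    cellAvg N L i (fun X => ∑ t ∈ s, f t X) = fun X => ∑ t ∈ s, cellAvg N L i (f t) X := by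
  have h := cellAvg_finset_sum (L := L) s (fun _ => (1 : ℂ)) hf i
  simpa only [one_mul] using h

/-- `P_i^{(n)}` through a finite sum of continuous functions. [folklore] -/
theorem fourierAvg_sum {ι : Type*} (s : Finset ι) (n : Fin 3 → ℤ) {f : ι → Config (m + 1) → ℂ}
    (hf : ∀ t ∈ s, Continuous (f t)) (i : Fin (m + 1)) :
    fourierAvg m L n i (fun X => ∑ t ∈ s, f t X) = fun X => ∑ t ∈ s, fourierAvg m L n i (f t) X := by
  have hc : ∀ t ∈ s, Continuous fun X : Config (m + 1) => conj (cellWave L n (X i)) * f t X := fun t ht =>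
    ((Complex.continuous_conj.comp (continuous_cellWave L n)).comp (continuous_apply i)).mul (hf t ht)
  rw [← cellAvg_conj_cellWave_mul]
  have h : (fun X : Config (m + 1) => conj (cellWave L n (X i)) * ∑ t ∈ s, f t X) =
      fun X => ∑ t ∈ s, conj (cellWave L n (X i)) * f t X := funext fun X => Finset.mul_sum _ _ _
  rw [h, cellAvg_sum s hc i]
  funext X
  exact Finset.sum_congr rfl fun t _ => by rw [← cellAvg_conj_cellWave_mul]

/-- **Mixed commutation of the slot operators**: for `i ≠ l` and continuous `g`,
`b_i (P_l^{(n)} g) = P_l^{(n)} (b_i g)` with `b_i g = e_n(x_i)·P_i g` (the phase `e_n(x_i)` is flat in slot `l`,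
and `P_l^{(n)} P_i = P_i P_l^{(n)}`, `Sector.fourierAvg_cellAvg_comm`). [folklore] -/
theorem up_down_comm (n : Fin 3 → ℤ) {i l : Fin (m + 1)} (hil : i ≠ l) {g : Config (m + 1) → ℂ}
    (hg : Continuous g) :
    (fun X => cellWave L n (X i) * cellAvg (m + 1) L i (fourierAvg m L n l g) X) =
      fourierAvg m L n l (fun X => cellWave L n (X i) * cellAvg (m + 1) L i g X) := by
  have hflat : ∀ (X : Config (m + 1)) (z : Space),
      cellWave L n (Function.update X l z i) = cellWave L n (X i) := fun X z => by
    rw [Function.update_of_ne hil]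
  rw [fourierAvg_mul_flat n l hflat, fourierAvg_cellAvg_comm hil n hg]

/-! ## Adjointness of the slot operators against a weight flat in the slot -/

/-- **`𝓥_w(b_l f, g) = 𝓥_w(f, P_l^{(n)} g)`** for a continuous real weight `w` flat in slot `l` and continuous
`f, g` (`P_l` is self-adjoint and `w`, being independent of `x_l`, passes through `P_l`). [folklore] -/
theorem form_up_adjoint (n : Fin 3 → ℤ) (l : Fin (m + 1)) {w : Config (m + 1) → ℝ} (hw : Continuous w)
    (hwl : ∀ X z, w (Function.update X l z) = w X) {f g : Config (m + 1) → ℂ} (hf : Continuous f)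
    (hg : Continuous g) :
    ∫ X in cellN (m + 1) L, ((w X : ℝ) : ℂ) *
        (conj (cellWave L n (X l) * cellAvg (m + 1) L l f X) * g X) =
      ∫ X in cellN (m + 1) L, ((w X : ℝ) : ℂ) * (conj (f X) * fourierAvg m L n l g X) := by
  set h : Config (m + 1) → ℂ := fun X => conj (cellWave L n (X l)) * (((w X : ℝ) : ℂ) * g X) with hh
  have hhc : Continuous h :=
    ((Complex.continuous_conj.comp (continuous_cellWave L n)).comp (continuous_apply l)).mul
      ((Complex.continuous_ofReal.comp hw).mul hg)
  have hwu : ∀ (X : Config (m + 1)) (z : Space),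
      (((w (Function.update X l z) : ℝ) : ℂ)) = ((w X : ℝ) : ℂ) := fun X z => by rw [hwl]
  have hPh : cellAvg (m + 1) L l h = fun X => ((w X : ℝ) : ℂ) * fourierAvg m L n l g X := by
    rw [hh, cellAvg_conj_cellWave_mul n l, fourierAvg_mul_flat n l hwu g]
  calc ∫ X in cellN (m + 1) L, ((w X : ℝ) : ℂ) *
        (conj (cellWave L n (X l) * cellAvg (m + 1) L l f X) * g X)
      = ∫ X in cellN (m + 1) L, conj (cellAvg (m + 1) L l f X) * h X := by
        refine integral_congr_ae (Eventually.of_forall fun X => ?_)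
        simp only [hh, map_mul]
        ring
    _ = ∫ X in cellN (m + 1) L, conj (f X) * cellAvg (m + 1) L l h X := (integral_conj_mul_cellAvg l hf hhc).symm
    _ = ∫ X in cellN (m + 1) L, ((w X : ℝ) : ℂ) * (conj (f X) * fourierAvg m L n l g X) := by
        rw [hPh]
        refine integral_congr_ae (Eventually.of_forall fun X => ?_)
        simp only
        ring

/-- **`𝓥_w(P_l^{(n)} f, g) = 𝓥_w(f, b_l g)`** (the conjugate-symmetric companion of `form_up_adjoint`). [folklore] -/
theorem form_down_adjoint (n : Fin 3 → ℤ) (l : Fin (m + 1)) {w : Config (m + 1) → ℝ} (hw : Continuous w)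
    (hwl : ∀ X z, w (Function.update X l z) = w X) {f g : Config (m + 1) → ℂ} (hf : Continuous f)
    (hg : Continuous g) :
    ∫ X in cellN (m + 1) L, ((w X : ℝ) : ℂ) * (conj (fourierAvg m L n l f X) * g X) =
      ∫ X in cellN (m + 1) L, ((w X : ℝ) : ℂ) *
        (conj (f X) * (cellWave L n (X l) * cellAvg (m + 1) L l g X)) := by
  rw [form_conj_symm w g (fourierAvg m L n l f), ← form_up_adjoint n l hw hwl hg hf,
    ← form_conj_symm w _ f]

end PlainInteraction

/-- **Part 1 of `stub_plainInteraction` (registered helper statement)**: adjointness of the slot operator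
`b_l f = e_n(x_l)·P_l f` against a continuous real weight `w` flat in slot `l` — for continuous `f, g`,
`∫ w conj(b_l f) g = ∫ w conj(f) P_l^{(n)} g` (`P_l` is self-adjoint and `w` passes through `P_l`). [folklore]
(KennedyLiebShastry1988 §2; arXiv:1211.2778 §2; LSSY2005 App. A) -/
theorem plainInteraction_form_up_adjoint :
    ∀ (m : ℕ) (L : ℝ) (n : Fin 3 → ℤ) (l : Fin (m + 1))
      (w : Literature.MathematicalPhysics.QuantumManyBody.BoseGas.Config (m + 1) → ℝ), Continuous w →
      (∀ (X : Literature.MathematicalPhysics.QuantumManyBody.BoseGas.Config (m + 1))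
          (z : Literature.MathematicalPhysics.QuantumManyBody.BoseGas.Space), w (Function.update X l z) = w X) →
      ∀ (f g : Literature.MathematicalPhysics.QuantumManyBody.BoseGas.Config (m + 1) → ℂ), Continuous f →
        Continuous g →
        ∫ X in Literature.MathematicalPhysics.QuantumManyBody.BoseGas.cellN (m + 1) L, ((w X : ℝ) : ℂ) *
            (conj (Literature.MathematicalPhysics.QuantumManyBody.BoseGas.cellWave L n (X l) *
              Summit.AtomisticToContinuum.BoseEinsteinCondensation.Theorems.GaussianDominationCan.Negative.cellAvg
                (m + 1) L l f X) * g X) =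
          ∫ X in Literature.MathematicalPhysics.QuantumManyBody.BoseGas.cellN (m + 1) L, ((w X : ℝ) : ℂ) *
            (conj (f X) *
              Summit.AtomisticToContinuum.BoseEinsteinCondensation.Cruxes.GDTransfer.DysonDressedWitness.fourierAvg
                m L n l g X) :=
  fun _ _ n l _ hw hwl _ _ hf hg => PlainInteraction.form_up_adjoint n l hw hwl hf hg

end Summit.AtomisticToContinuum.BoseEinsteinCondensation.Cruxes.GDTransfer.Seeded

end
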